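import Summits.ResolutionOfSingularities.ResolutionOfSingularities.Theorems.FrobeniusLadderFRationalResolutionSuspensionCalibration
import Summits.ResolutionOfSingularities.ResolutionOfSingularities.Theorems.FrobeniusLadderFRationalResolutionCoverSq
import Summits.ResolutionOfSingularities.ResolutionOfSingularities.Theorems.FrobeniusLadderFRationalResolutionChartGraphSq
import Literature.AlgebraicGeometry.Resolution.BlowupAlgebraPresentation
import Literature.AlgebraicGeometry.Resolution.AffineBlowupRegular
import HarnessLib

/-!
# Rung 4′ at the first singular member of the residual class: the quadric cone, resolved

Support file for crux stmt-ResolutionOfSingularities-15317 (`FrobeniusLadder.FRationalResolution`),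
line `Sketch`, continuation seat c2, wave 2. By the suspension calibration
(`fRationalResolution_resolves_singular_suspension`) the crux must resolve every hyperbolic
suspension `Σf = {yz + f = 0}`, and `Σf` is singular for `f ∈ (x)²`. Here the FIRST such surface,
the quadric cone `Σ(x²) = Spec k[y,z,x]/(yz + x²)`, IS RESOLVED — unconditionally, for every field
`k` of any characteristic — by ONE blowing up of the vertex, with the tree's blow-up library
(`affineBlowup I = Proj R[It]`, proper and birational over `Spec R`: `affineBlowup.isResolution`;
charts = affine blowup algebras `R[I/a]`, `reesChartEquiv`; cover
`affineBlowup.iSup_basicOpen_reesT_generators_eq_top`):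

* `isPrime_span_suspension` — `(yz + f)` is prime in `k[y,z,x₁..xₙ]` for `f ≠ 0`
  (`stub_suspensionKernel` through `MvPolynomial.sumAlgEquiv`);
* `adjoin_mk_X_eq_top` — the images of the variables generate `k[y,z,x]/(g)`;
* `hasResolution_quadricCone` — **`Scheme.HasResolution (Spec k[y,z,x]/(yz + x²))`**: the graph
  charts `R[I/y] ≅ k[Y, X']`, `R[I/z] ≅ k[Z, X']` are regular (`stub_chart_graph_sq`, test maps by
  `Ideal.Quotient.liftₐ`), and `D₊(xt) ⊆ D₊(yt)` (`stub_cover_sq`);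
* `quadricCone_singular_hasResolution` — together with `suspension_not_isRegular`: a SINGULAR
  member of the residual class with a resolution in Lean (rung 4′ in dimension 2 was so far only
  conditional on `CossartJannsenSaito2020`, p131133).

References: Hartshorne II.7 / Stacks 0804, 052P (blowing up, affine blowup algebras); Kollár 2007
§2.2 (resolution of surface double points); calibration note
`Cruxes/FRationalResolution/NEGATIVE-suspension-calibration.md`.
-/

-- single-problem summit: the doubled namespace component `ResolutionOfSingularities` is forced
set_option linter.dupNamespace false

noncomputable section

open CategoryTheory AlgebraicGeometry TopologicalSpace
open Literature.AlgebraicGeometry.Resolution Literature.RingTheory.TightClosure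

namespace Summit.ResolutionOfSingularities.ResolutionOfSingularities.Theorems.FRationalResolution

section ConeSq

open MvPolynomial

variable (k : Type) [Field k]

/-- `yz + f` generates a prime ideal of `k[y,z,x₁..xₙ]` for `f ≠ 0` (bridge to
`stub_suspensionKernel` through `MvPolynomial.sumAlgEquiv`). -/
theorem isPrime_span_suspension (n : ℕ) (f : MvPolynomial (Fin n) k) (hf : f ≠ 0) :
    (Ideal.span {(X (Sum.inl 0) * X (Sum.inl 1) + rename Sum.inr f :
      MvPolynomial (Fin 2 ⊕ Fin n) k)}).IsPrime := by
  set e := sumAlgEquiv k (Fin 2) (Fin n) with he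
  set g₂ : MvPolynomial (Fin 2) (MvPolynomial (Fin n) k) := X 0 * X 1 + C f with hg₂
  have heg : e (X (Sum.inl 0) * X (Sum.inl 1) + rename Sum.inr f) = g₂ := sumAlgEquiv_suspension k n f
  have hegs : e.symm g₂ = X (Sum.inl 0) * X (Sum.inl 1) + rename Sum.inr f := by
    rw [← heg, e.symm_apply_apply]
  obtain ⟨hprime₂, -⟩ := stub_suspensionKernel (MvPolynomial (Fin n) k) f hf
  have hspan : Ideal.span {(X (Sum.inl 0) * X (Sum.inl 1) + rename Sum.inr f :
      MvPolynomial (Fin 2 ⊕ Fin n) k)} = (Ideal.span {g₂}).comap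
      (e : MvPolynomial (Fin 2 ⊕ Fin n) k →+* MvPolynomial (Fin 2) (MvPolynomial (Fin n) k)) := by
    apply le_antisymm
    · rw [Ideal.span_singleton_le_iff_mem, Ideal.mem_comap]
      change e _ ∈ Ideal.span {g₂}
      rw [heg]
      exact Ideal.mem_span_singleton_self g₂
    · intro x hx
      rw [Ideal.mem_comap] at hx
      obtain ⟨r, hr⟩ := Ideal.mem_span_singleton'.mp hx
      have hx' : x = e.symm r * (X (Sum.inl 0) * X (Sum.inl 1) + rename Sum.inr f) := by
        have := congrArg e.symm hr
        rw [map_mul, hegs] at this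
        rw [this]
        exact (e.symm_apply_apply x).symm
      rw [hx']
      exact Ideal.mul_mem_left _ _ (Ideal.mem_span_singleton_self _)
  rw [hspan]
  exact Ideal.comap_isPrime _ _

/-- The generators `x̄, ȳ, z̄` of `k[y,z,x]/(yz + x²)` generate it as a `k`-algebra. -/
theorem adjoin_mk_X_eq_top (g : MvPolynomial (Fin 2 ⊕ Fin 1) k) :
    Algebra.adjoin k {Ideal.Quotient.mk (Ideal.span {g}) (X (Sum.inr 0)),
      Ideal.Quotient.mk (Ideal.span {g}) (X (Sum.inl 0)),
      Ideal.Quotient.mk (Ideal.span {g}) (X (Sum.inl 1))} = ⊤ := by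
  have hrange : (Set.range (X : Fin 2 ⊕ Fin 1 → MvPolynomial (Fin 2 ⊕ Fin 1) k)) =
      {X (Sum.inr 0), X (Sum.inl 0), X (Sum.inl 1)} := by
    ext q
    simp only [Set.mem_range, Set.mem_insert_iff, Set.mem_singleton_iff]
    constructor
    · rintro ⟨i, rfl⟩
      rcases i with i | i
      · fin_cases i <;> simp
      · fin_cases i; simp
    · rintro (rfl | rfl | rfl)
      · exact ⟨Sum.inr 0, rfl⟩
      · exact ⟨Sum.inl 0, rfl⟩
      · exact ⟨Sum.inl 1, rfl⟩
  have h1 : Algebra.adjoin k (Set.range (X : Fin 2 ⊕ Fin 1 → MvPolynomial (Fin 2 ⊕ Fin 1) k)) = ⊤ :=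
    MvPolynomial.adjoin_range_X
  have h2 := congrArg (Subalgebra.map (Ideal.Quotient.mkₐ k (Ideal.span {g}))) h1
  rw [AlgHom.map_adjoin, Algebra.map_top, (AlgHom.range_eq_top _).mpr
    (Ideal.Quotient.mkₐ_surjective k (Ideal.span {g})), hrange] at h2
  simpa [Set.image_insert_eq, Set.image_singleton, Ideal.Quotient.mkₐ_eq_mk] using h2

/-- **The blow-up of the quadric cone at its vertex is regular, and the cone has a resolution of
singularities** — for EVERY field `k`: `X = Spec k[y,z,x]/(yz + x²)`, `I = (y, z, x)`,
`Bl_I X = Proj R[It] → X` is proper birational (tree: `affineBlowup.isResolution`) and regular: the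
charts `D₊(yt), D₊(zt)` are the spectra of the graph charts `R[I/y] ≅ k[Y, X']`, `R[I/z] ≅ k[Z, X']`
(`stub_chart_graph_sq`, test maps by `Ideal.Quotient.liftₐ`), and `D₊(xt) ⊆ D₊(yt)`
(`stub_cover_sq`). This is the crux's rung 4′ at the FIRST SINGULAR member of the residual class
(`suspension_calibration` with `n = 1`, `f = x²`), unconditionally and in every characteristic. -/
theorem hasResolution_quadricCone :
    Scheme.HasResolution (Spec (CommRingCat.of (MvPolynomial (Fin 2 ⊕ Fin 1) k ⧸ Ideal.span
      {(MvPolynomial.X (Sum.inl 0) * MvPolynomial.X (Sum.inl 1) +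
        MvPolynomial.rename Sum.inr (MvPolynomial.X 0 ^ 2) : MvPolynomial (Fin 2 ⊕ Fin 1) k)}))) := by
  -- the equation, the ring and its generators
  set g : MvPolynomial (Fin 2 ⊕ Fin 1) k :=
    X (Sum.inl 0) * X (Sum.inl 1) + rename Sum.inr (X 0 ^ 2) with hg
  haveI hprime : (Ideal.span {g}).IsPrime :=
    isPrime_span_suspension k 1 (X 0 ^ 2) (pow_ne_zero _ (X_ne_zero 0))
  haveI : IsDomain (MvPolynomial (Fin 2 ⊕ Fin 1) k ⧸ Ideal.span {g}) := Ideal.Quotient.isDomain _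
  set mk : MvPolynomial (Fin 2 ⊕ Fin 1) k →ₐ[k] MvPolynomial (Fin 2 ⊕ Fin 1) k ⧸ Ideal.span {g} :=
    Ideal.Quotient.mkₐ k (Ideal.span {g}) with hmk
  set xb := mk (X (Sum.inr 0)) with hxb
  set yb := mk (X (Sum.inl 0)) with hyb
  set zb := mk (X (Sum.inl 1)) with hzb
  have hrel : yb * zb + xb ^ 2 = 0 := by
    have : mk g = 0 := by
      rw [hmk, Ideal.Quotient.mkₐ_eq_mk, Ideal.Quotient.eq_zero_iff_mem]
      exact Ideal.mem_span_singleton_self g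
    simpa [hg, map_add, map_mul, map_pow, rename_X] using this
  have hrel' : zb * yb + xb ^ 2 = 0 := by rw [mul_comm]; exact hrel
  have hgen : Algebra.adjoin k {xb, yb, zb} = ⊤ := adjoin_mk_X_eq_top k g
  have hgen' : Algebra.adjoin k {xb, zb, yb} = ⊤ := by
    rw [← hgen]; congr 1; ext q; simp only [Set.mem_insert_iff, Set.mem_singleton_iff]; tauto
  -- test maps `θy`, `θz`
  have hlift : ∀ (θ₀ : MvPolynomial (Fin 2 ⊕ Fin 1) k →ₐ[k]
      Localization.Away (MvPolynomial.X 0 : MvPolynomial (Fin 2) k)), θ₀ g = 0 →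
      ∀ s ∈ Ideal.span {g}, θ₀ s = 0 := by
    intro θ₀ h0 s hs
    obtain ⟨r, rfl⟩ := Ideal.mem_span_singleton'.mp hs
    rw [map_mul, h0, mul_zero]
  set u₀ := algebraMap (MvPolynomial (Fin 2) k)
    (Localization.Away (MvPolynomial.X 0 : MvPolynomial (Fin 2) k)) (X 0) with hu₀
  set u₁ := algebraMap (MvPolynomial (Fin 2) k)
    (Localization.Away (MvPolynomial.X 0 : MvPolynomial (Fin 2) k)) (X 1) with hu₁
  set θy₀ : MvPolynomial (Fin 2 ⊕ Fin 1) k →ₐ[k]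
      Localization.Away (MvPolynomial.X 0 : MvPolynomial (Fin 2) k) :=
    aeval (Sum.elim ![u₀, -(u₁ ^ 2 * u₀)] ![u₁ * u₀]) with hθy₀
  have hθy₀y : θy₀ (X (Sum.inl 0)) = u₀ := by simp [hθy₀]
  have hθy₀z : θy₀ (X (Sum.inl 1)) = -(u₁ ^ 2 * u₀) := by simp [hθy₀]
  have hθy₀x : θy₀ (X (Sum.inr 0)) = u₁ * u₀ := by simp [hθy₀]
  have hθy₀g : θy₀ g = 0 := by
    rw [hg, map_add, map_mul, hθy₀y, hθy₀z, aeval_rename, map_pow, Function.comp_def, aeval_X,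
      Sum.elim_inr, Matrix.cons_val_zero]
    ring
  set θy := Ideal.Quotient.liftₐ (Ideal.span {g}) θy₀ (hlift θy₀ hθy₀g) with hθy
  have hθy_mk : ∀ s, θy (mk s) = θy₀ s := fun s =>
    AlgHom.congr_fun (Ideal.Quotient.liftₐ_comp (Ideal.span {g}) θy₀ (hlift θy₀ hθy₀g)) s
  set θz₀ : MvPolynomial (Fin 2 ⊕ Fin 1) k →ₐ[k]
      Localization.Away (MvPolynomial.X 0 : MvPolynomial (Fin 2) k) :=
    aeval (Sum.elim ![-(u₁ ^ 2 * u₀), u₀] ![u₁ * u₀]) with hθz₀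
  have hθz₀y : θz₀ (X (Sum.inl 0)) = -(u₁ ^ 2 * u₀) := by simp [hθz₀]
  have hθz₀z : θz₀ (X (Sum.inl 1)) = u₀ := by simp [hθz₀]
  have hθz₀x : θz₀ (X (Sum.inr 0)) = u₁ * u₀ := by simp [hθz₀]
  have hθz₀g : θz₀ g = 0 := by
    rw [hg, map_add, map_mul, hθz₀y, hθz₀z, aeval_rename, map_pow, Function.comp_def, aeval_X,
      Sum.elim_inr, Matrix.cons_val_zero]
    ring
  set θz := Ideal.Quotient.liftₐ (Ideal.span {g}) θz₀ (hlift θz₀ hθz₀g) with hθz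
  have hθz_mk : ∀ s, θz (mk s) = θz₀ s := fun s =>
    AlgHom.congr_fun (Ideal.Quotient.liftₐ_comp (Ideal.span {g}) θz₀ (hlift θz₀ hθz₀g)) s
  -- the two graph charts are regular rings
  have hBy : IsRegularRing (blowupAlgebra (Ideal.span {xb, yb, zb}) yb) := by
    refine stub_chart_graph_sq k _ xb yb zb hrel hgen θy ?_ ?_ ?_
    · rw [hyb, hθy_mk, hθy₀y]
    · rw [hxb, hθy_mk, hθy₀x, map_mul]
    · rw [hzb, hθy_mk, hθy₀z, map_mul, map_pow]
  have hBz : IsRegularRing (blowupAlgebra (Ideal.span {xb, yb, zb}) zb) := by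
    have h := stub_chart_graph_sq k _ xb zb yb hrel' hgen' θz ?_ ?_ ?_
    · have hset : ({xb, zb, yb} : Set (MvPolynomial (Fin 2 ⊕ Fin 1) k ⧸ Ideal.span {g})) =
          {xb, yb, zb} := by
        ext q; simp only [Set.mem_insert_iff, Set.mem_singleton_iff]; tauto
      rwa [hset] at h
    · rw [hzb, hθz_mk, hθz₀z]
    · rw [hxb, hθz_mk, hθz₀x, map_mul]
    · rw [hyb, hθz_mk, hθz₀y, map_mul, map_pow]
  -- the centre as the span of a family, for the chart cover
  set v : Fin 3 → MvPolynomial (Fin 2 ⊕ Fin 1) k ⧸ Ideal.span {g} := ![yb, zb, xb] with hv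
  have hIv : Ideal.span (Set.range v) = Ideal.span {xb, yb, zb} := by
    congr 1
    ext q
    simp only [hv, Matrix.range_cons, Matrix.range_empty, Set.union_empty, Set.union_singleton,
      Set.mem_insert_iff, Set.mem_singleton_iff, Set.mem_union]
    tauto
  have hyI : yb ∈ Ideal.span (Set.range v) := Ideal.subset_span ⟨0, rfl⟩
  have hzI : zb ∈ Ideal.span (Set.range v) := Ideal.subset_span ⟨1, rfl⟩
  have hxI : xb ∈ Ideal.span (Set.range v) := Ideal.subset_span ⟨2, rfl⟩
  -- regularity of the blow-up
  have hreg : Scheme.IsRegular (affineBlowup (Ideal.span (Set.range v))) := by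
    refine Scheme.IsRegular.of_forall_exists_isOpenImmersion fun p => ?_
    have hp : p ∈ (⨆ i : Fin 3, Proj.basicOpen (reesGrading (Ideal.span (Set.range v)))
        (reesT (v i) (Ideal.mem_span_range_self (f := v) (x := i)))) := by
      rw [affineBlowup.iSup_basicOpen_reesT_generators_eq_top v]; trivial
    obtain ⟨i, hi⟩ := Opens.mem_iSup.mp hp
    -- every point lies in the `y`- or the `z`-chart
    have hyz : p ∈ Proj.basicOpen (reesGrading (Ideal.span (Set.range v))) (reesT yb hyI) ∨
        p ∈ Proj.basicOpen (reesGrading (Ideal.span (Set.range v))) (reesT zb hzI) := by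
      fin_cases i
      · exact Or.inl hi
      · exact Or.inr hi
      · exact Or.inl (stub_cover_sq _ _ xb yb zb hxI hyI hzI hrel hi)
    have chart : ∀ (b : MvPolynomial (Fin 2 ⊕ Fin 1) k ⧸ Ideal.span {g})
        (hb : b ∈ Ideal.span (Set.range v)),
        IsRegularRing (blowupAlgebra (Ideal.span (Set.range v)) b) →
        p ∈ Proj.basicOpen (reesGrading (Ideal.span (Set.range v))) (reesT b hb) →
        ∃ (U : Scheme) (j : U ⟶ affineBlowup (Ideal.span (Set.range v))),
          IsOpenImmersion j ∧ p ∈ Set.range j ∧ Scheme.IsRegular U := by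
      intro b hb hB hpb
      haveI := hB
      haveI : IsRegularRing (CommRingCat.of (HomogeneousLocalization.Away
          (reesGrading (Ideal.span (Set.range v))) (reesT b hb))) :=
        IsRegularRing.of_ringEquiv (reesChartEquiv b hb).symm
      refine ⟨_, Proj.awayι (reesGrading (Ideal.span (Set.range v))) (reesT b hb) (reesT_mem b hb)
        Nat.one_pos, inferInstance, ?_, Scheme.isRegular_Spec _⟩
      rw [← Scheme.Hom.coe_opensRange, Proj.opensRange_awayι]
      exact hpb
    rcases hyz with h | h
    · exact chart yb hyI (by rw [hIv]; exact hBy) h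
    · exact chart zb hzI (by rw [hIv]; exact hBz) h
  -- the centre is non-zero: `θy ȳ = Y ≠ 0`
  have hI0 : Ideal.span (Set.range v) ≠ ⊥ := by
    intro h0
    have hy0 : yb = 0 := by simpa [h0] using hyI
    have h1 : θy yb = u₀ := by rw [hyb, hθy_mk, hθy₀y]
    rw [hy0, map_zero] at h1
    have hinj : Function.Injective (algebraMap (MvPolynomial (Fin 2) k)
        (Localization.Away (MvPolynomial.X 0 : MvPolynomial (Fin 2) k))) :=
      IsLocalization.injective _ (powers_le_nonZeroDivisors_of_noZeroDivisors (X_ne_zero 0))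
    exact X_ne_zero (R := k) (0 : Fin 2) (hinj (by rw [map_zero]; exact h1.symm))
  exact ⟨_, affineBlowup.π _, affineBlowup.isResolution hI0 hreg⟩

end ConeSq

/-- **A singular member of the residual class, resolved.** For every prime `p` and every field `k`
of characteristic `p`, the quadric cone `Σ(x²) = Spec k[y,z,x]/(yz + x²)` is NOT regular
(`suspension_not_isRegular`, `x² ∈ (x)²`), lies in the hypothesis class of the crux
(`suspension_package`), and HAS a resolution of singularities (`hasResolution_quadricCone`):
rung 4′ of line `Sketch` holds at it unconditionally. -/
theorem quadricCone_singular_hasResolution (k : Type) [Field k] (p : ℕ) [Fact p.Prime] [CharP k p] :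
    ¬ Scheme.IsRegular (Spec (CommRingCat.of (MvPolynomial (Fin 2 ⊕ Fin 1) k ⧸ Ideal.span
      {(MvPolynomial.X (Sum.inl 0) * MvPolynomial.X (Sum.inl 1) +
        MvPolynomial.rename Sum.inr (MvPolynomial.X 0 ^ 2) : MvPolynomial (Fin 2 ⊕ Fin 1) k)}))) ∧
    Scheme.HasResolution (Spec (CommRingCat.of (MvPolynomial (Fin 2 ⊕ Fin 1) k ⧸ Ideal.span
      {(MvPolynomial.X (Sum.inl 0) * MvPolynomial.X (Sum.inl 1) +
        MvPolynomial.rename Sum.inr (MvPolynomial.X 0 ^ 2) : MvPolynomial (Fin 2 ⊕ Fin 1) k)}))) :=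
  ⟨suspension_not_isRegular k 1 (MvPolynomial.X 0 ^ 2) p (pow_ne_zero _ (MvPolynomial.X_ne_zero 0))
    (Ideal.pow_mem_pow (Ideal.subset_span (Set.mem_range_self 0)) 2),
    hasResolution_quadricCone k⟩

end Summit.ResolutionOfSingularities.ResolutionOfSingularities.Theorems.FRationalResolution

end
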